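import Summits.AtomisticToContinuum.FouriersLaw.Theorems.OddSectorIrreversibilityOddDensityIsCorrectorCoboundary
import Summits.AtomisticToContinuum.FouriersLaw.Theorems.OddSectorIrreversibilityOddDensityIsCorrectorAbelLimit
import Summits.AtomisticToContinuum.FouriersLaw.Theorems.OddSectorIrreversibilityOddDensityIsCorrectorMainPrep
import Summits.AtomisticToContinuum.FouriersLaw.Theorems.OddSectorIrreversibilityCorrectorTheoryExistence

/-!
# `OpenChainGreenKubo` (stmt-AtomisticToContinuum-12696), KDN step 1: Gibbs pairings of resolvents and Kubo
# integrals with nice observables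

Helper file (`--supports`) for the support item `HonestZwanzig.OpenChainGreenKubo`. Bookkeeping for the
Kundu–Dhar–Narayan identity `∫₀^∞ ∫ g (P_s J) dμ_T ds = ∫₀^∞ corr(J,J) ds / (N-1)` (next file): for the equilibrium
kernels `P_t = transitionKernel N T T t` of the pinned chain, the Gibbs measure `μ_T`, NICE observables `A, f`
(continuous, `|·| ≤ C e^{ϑH}`, `0 < ϑ`, `2ϑ < 1/T`), the resolvent `R_λ f(z) = ∫_{(0,∞)} e^{-λt} P_t f(z) dt` and, for
centred `f`, the Kubo integral `R₀ f(z) = ∫_{(0,∞)} P_t f(z) dt`: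

* `integrable_nice_mul_of_abs_le_exp` — `A · W ∈ L¹(μ_T)` whenever `|W| ≤ D e^{ϑH}` and `W` is strongly measurable
  (`e^{2ϑH} ∈ L¹(μ_T)`); hence `A · R_λ f`, `A · R₀ f ∈ L¹(μ_T)`;
* `abs_integral_nice_mul_le` — `|∫ A W dμ_T| ≤ C_A D ∫ e^{2ϑH} dμ_T`;
* `integral_Ioi_integral_nice_mul_act` — **Fubini**: `∫_{(0,∞)} ∫ A · P_t f dμ_T dt = ∫ A · R₀ f dμ_T` for centred nice
  `f` (the integrand is dominated by `C_A K C e^{2ϑH(z)} e^{-ct}`, CEHR (2.5)).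

No definitions.
-/

noncomputable section

open MeasureTheory ProbabilityTheory Filter Topology Set Function
open scoped NNReal ENNReal ContDiff BigOperators

namespace Summit.AtomisticToContinuum.FouriersLaw.Theorems.OpenChainGreenKubo

open Literature.MathematicalPhysics.KineticTheory.HeatConduction
open Literature.MathematicalPhysics.KineticTheory OscillatorChain
open Summit.AtomisticToContinuum.FouriersLaw.Theorems.OddSectorIrreversibility
open Summit.AtomisticToContinuum.FouriersLaw.Theorems.OddSectorIrreversibility.Corrector
open Literature.Barriers.AtomisticToContinuum.OpenChain

variable {N : ℕ}

section Pinned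

variable {ω₂ lam β γ : ℝ} (hω : 0 < ω₂) (hl : 0 ≤ lam) (hβ : 0 < β) (hγ : 0 < γ) (hN : 0 < N)
  {T : ℝ} (hT : 0 < T)
include hω hl hβ hγ hN hT

omit hγ hN in
/-- **Products of nice observables with `e^{ϑH}`-dominated measurable functions are `μ_T`-integrable** (`2ϑ < 1/T`):
if `A` is continuous with `|A| ≤ C_A e^{ϑH}` and `W` is strongly measurable with `|W| ≤ D e^{ϑH}` then `A W ∈ L¹(μ_T)` and
`|∫ A W dμ_T| ≤ C_A D ∫ e^{2ϑH} dμ_T`. [folklore] -/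
theorem integrable_nice_mul_of_abs_le_exp {ϑ : ℝ} (h2ϑ : 2 * ϑ < 1 / T)
    {A W : PhaseSpace N → ℝ} (hA : Continuous A) (hW : StronglyMeasurable W) {CA D : ℝ}
    (hAb : ∀ y, |A y| ≤ CA * Real.exp (ϑ * (pinnedChain ω₂ lam β γ).hamiltonian N y))
    (hWb : ∀ y, |W y| ≤ D * Real.exp (ϑ * (pinnedChain ω₂ lam β γ).hamiltonian N y)) :
    Integrable (fun z => A z * W z) ((pinnedChain ω₂ lam β γ).gibbsMeasure N T) ∧
      |∫ z, A z * W z ∂((pinnedChain ω₂ lam β γ).gibbsMeasure N T)| ≤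
        CA * D * ∫ z, Real.exp (2 * ϑ * (pinnedChain ω₂ lam β γ).hamiltonian N z)
          ∂((pinnedChain ω₂ lam β γ).gibbsMeasure N T) := by
  set P := pinnedChain ω₂ lam β γ with hP
  have hexp := pinnedChain_integrable_exp_mul_hamiltonian_gibbsMeasure hω hl hβ.le γ N hT h2ϑ
  have hbound : ∀ z, |A z * W z| ≤ CA * D * Real.exp (2 * ϑ * P.hamiltonian N z) := fun z => by
    rw [abs_mul, show 2 * ϑ * P.hamiltonian N z = ϑ * P.hamiltonian N z + ϑ * P.hamiltonian N z by ring,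
      Real.exp_add]
    calc |A z| * |W z| ≤ (CA * Real.exp (ϑ * P.hamiltonian N z)) * (D * Real.exp (ϑ * P.hamiltonian N z)) :=
          mul_le_mul (hAb z) (hWb z) (abs_nonneg _) ((abs_nonneg _).trans (hAb z))
      _ = _ := by ring
  have hint : Integrable (fun z => A z * W z) (P.gibbsMeasure N T) :=
    (hexp.const_mul (CA * D)).mono' (hA.aestronglyMeasurable.mul hW.aestronglyMeasurable)
      (Eventually.of_forall fun z => by rw [Real.norm_eq_abs]; exact hbound z)
  refine ⟨hint, ?_⟩
  calc |∫ z, A z * W z ∂(P.gibbsMeasure N T)| ≤ ∫ z, |A z * W z| ∂(P.gibbsMeasure N T) := abs_integral_le_integral_abs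
    _ ≤ ∫ z, CA * D * Real.exp (2 * ϑ * P.hamiltonian N z) ∂(P.gibbsMeasure N T) :=
        integral_mono_of_nonneg (Eventually.of_forall fun z => abs_nonneg _) (hexp.const_mul _)
          (Eventually.of_forall hbound)
    _ = _ := integral_const_mul _ _

/-- **Fubini for the Kubo pairing**: for a nice `A` and a CENTRED nice `f` (`μ_T(f) = 0`),
`∫_{(0,∞)} ∫ A · (P_t f) dμ_T dt = ∫ A · R₀ f dμ_T`, `R₀ f(z) = ∫_{(0,∞)} P_t f(z) dt`; the double integrand is dominated by
`C_A K C e^{2ϑH(z)} e^{-ct}` (CEHR (2.5), `pinnedChain_harris_bound`), integrable on `(0,∞) × μ_T` for `2ϑ < 1/T`.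
[cite: CuneoEckmannHairerReyBellet2018, Thm 2.13 eq. (2.5)] -/
theorem integral_Ioi_integral_nice_mul_act {ϑ : ℝ} (hϑ0 : 0 < ϑ) (h2ϑ : 2 * ϑ < 1 / T)
    {A f : PhaseSpace N → ℝ} (hA : Continuous A) (hf : Continuous f) {CA C : ℝ} (hC : 0 ≤ C)
    (hAb : ∀ y, |A y| ≤ CA * Real.exp (ϑ * (pinnedChain ω₂ lam β γ).hamiltonian N y))
    (hfb : ∀ y, |f y| ≤ C * Real.exp (ϑ * (pinnedChain ω₂ lam β γ).hamiltonian N y))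
    (hf0 : ∫ y, f y ∂((pinnedChain ω₂ lam β γ).gibbsMeasure N T) = 0) :
    ∫ t in Ioi (0 : ℝ), ∫ z, A z * (∫ y, f y ∂((pinnedChain ω₂ lam β γ).transitionKernel N T T t.toNNReal z))
        ∂((pinnedChain ω₂ lam β γ).gibbsMeasure N T) =
      ∫ z, A z * (∫ t in Ioi (0 : ℝ), ∫ y, f y ∂((pinnedChain ω₂ lam β γ).transitionKernel N T T t.toNNReal z))
        ∂((pinnedChain ω₂ lam β γ).gibbsMeasure N T) := by
  set P := pinnedChain ω₂ lam β γ with hP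
  set μ := P.gibbsMeasure N T with hμ
  haveI : IsProbabilityMeasure μ := pinnedChain_isProbabilityMeasure_gibbsMeasure hω hl hβ.le γ N hT
  have hϑ1 : ϑ < 1 / T := by linarith
  obtain ⟨K, c, hK, hc, hb⟩ := pinnedChain_harris_bound hω hl hβ hγ hN hT hϑ0 hϑ1
  have hexp := pinnedChain_integrable_exp_mul_hamiltonian_gibbsMeasure hω hl hβ.le γ N hT h2ϑ
  -- the pointwise decay of `P_t f`
  have hdec : ∀ (t : ℝ) (z : PhaseSpace N), 0 < t →
      |∫ y, f y ∂(P.transitionKernel N T T t.toNNReal z)| ≤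
        K * C * Real.exp (ϑ * P.hamiltonian N z) * Real.exp (-c * t) := by
    intro t z ht
    have h := hb z t.toNNReal f hf C hC hfb
    rwa [hf0, sub_zero, Real.coe_toNNReal _ ht.le] at h
  -- joint measurability and integrability on `(0,∞) × μ_T`
  have hFm : AEStronglyMeasurable (fun q : ℝ × PhaseSpace N =>
      A q.2 * ∫ y, f y ∂(P.transitionKernel N T T q.1.toNNReal q.2)) ((volume.restrict (Ioi (0 : ℝ))).prod μ) :=
    ((hA.comp continuous_snd).aestronglyMeasurable).mul
      (pinnedChain_stronglyMeasurable_act_uncurry hω hl hβ.le hγ.le T T hf.measurable).aestronglyMeasurable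
  have hmaj : Integrable (fun q : ℝ × PhaseSpace N =>
      Real.exp (-c * q.1) * (CA * (K * C) * Real.exp (2 * ϑ * P.hamiltonian N q.2)))
      ((volume.restrict (Ioi (0 : ℝ))).prod μ) :=
    (exp_neg_integrableOn_Ioi 0 hc).mul_prod (hexp.const_mul _)
  have hslice : ∀ t : ℝ, 0 < t → Integrable (fun z => A z * ∫ y, f y ∂(P.transitionKernel N T T t.toNNReal z)) μ ∧
      |∫ z, A z * (∫ y, f y ∂(P.transitionKernel N T T t.toNNReal z)) ∂μ| ≤
        CA * (K * C * Real.exp (-c * t)) * ∫ z, Real.exp (2 * ϑ * P.hamiltonian N z) ∂μ := by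
    intro t ht
    have hWm : StronglyMeasurable fun z => ∫ y, f y ∂(P.transitionKernel N T T t.toNNReal z) :=
      hf.stronglyMeasurable.integral_kernel (κ := P.transitionKernel N T T t.toNNReal)
    refine integrable_nice_mul_of_abs_le_exp hω hl hβ hT h2ϑ hA hWm hAb fun z => ?_
    calc _ ≤ K * C * Real.exp (ϑ * P.hamiltonian N z) * Real.exp (-c * t) := hdec t z ht
      _ = _ := by ring
  have hFi : Integrable (fun q : ℝ × PhaseSpace N =>
      A q.2 * ∫ y, f y ∂(P.transitionKernel N T T q.1.toNNReal q.2)) ((volume.restrict (Ioi (0 : ℝ))).prod μ) := by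
    rw [integrable_prod_iff hFm]
    constructor
    · exact (ae_restrict_iff' measurableSet_Ioi).2 (Eventually.of_forall fun t ht => (hslice t ht).1)
    · have hm : AEStronglyMeasurable (fun t : ℝ => ∫ z, ‖A z * ∫ y, f y ∂(P.transitionKernel N T T t.toNNReal z)‖ ∂μ)
          (volume.restrict (Ioi (0 : ℝ))) := hFm.norm.integral_prod_right'
      refine Integrable.mono' (((exp_neg_integrableOn_Ioi 0 hc).const_mul
        (CA * (K * C) * ∫ z, Real.exp (2 * ϑ * P.hamiltonian N z) ∂μ))) hm ?_
      refine (ae_restrict_iff' measurableSet_Ioi).2 (Eventually.of_forall fun t ht => ?_)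
      rw [Real.norm_eq_abs, abs_of_nonneg (integral_nonneg fun z => norm_nonneg _)]
      have hpt : ∀ z, ‖A z * ∫ y, f y ∂(P.transitionKernel N T T t.toNNReal z)‖ ≤
          CA * (K * C * Real.exp (-c * t)) * Real.exp (2 * ϑ * P.hamiltonian N z) := fun z => by
        rw [Real.norm_eq_abs, abs_mul, show 2 * ϑ * P.hamiltonian N z =
          ϑ * P.hamiltonian N z + ϑ * P.hamiltonian N z by ring, Real.exp_add]
        calc |A z| * |∫ y, f y ∂(P.transitionKernel N T T t.toNNReal z)|
            ≤ (CA * Real.exp (ϑ * P.hamiltonian N z)) * (K * C * Real.exp (ϑ * P.hamiltonian N z) * Real.exp (-c * t)) :=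
              mul_le_mul (hAb z) (hdec t z ht) (abs_nonneg _) ((abs_nonneg _).trans (hAb z))
          _ = _ := by ring
      calc ∫ z, ‖A z * ∫ y, f y ∂(P.transitionKernel N T T t.toNNReal z)‖ ∂μ
          ≤ ∫ z, CA * (K * C * Real.exp (-c * t)) * Real.exp (2 * ϑ * P.hamiltonian N z) ∂μ :=
            integral_mono_of_nonneg (Eventually.of_forall fun z => norm_nonneg _) (hexp.const_mul _)
              (Eventually.of_forall hpt)
        _ = CA * (K * C) * (∫ z, Real.exp (2 * ϑ * P.hamiltonian N z) ∂μ) * Real.exp (-c * t) := by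
            rw [integral_const_mul]; ring
  -- Fubini
  have hswap := integral_integral_swap (μ := volume.restrict (Ioi (0 : ℝ))) (ν := μ)
    (f := fun (t : ℝ) (z : PhaseSpace N) => A z * ∫ y, f y ∂(P.transitionKernel N T T t.toNNReal z)) hFi
  rw [hswap]
  refine integral_congr_ae (Eventually.of_forall fun z => ?_)
  exact integral_const_mul _ _

omit hN in
/-- The resolvent instance of `integrable_nice_mul_of_abs_le_exp`: for nice `A, f` and `λ > 0`, `A · R_λ f ∈ L¹(μ_T)`
(`|R_λ f| ≤ (|μ_T(f)| + KC) e^{ϑH}/λ`, `pinnedChain_abs_resolvent_le`). [folklore] -/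
theorem integrable_nice_mul_resolvent (hN0 : 0 < N) {ϑ : ℝ} (hϑ0 : 0 < ϑ) (h2ϑ : 2 * ϑ < 1 / T)
    {A f : PhaseSpace N → ℝ} (hA : Continuous A) (hf : Continuous f) {CA C : ℝ} (hC : 0 ≤ C)
    (hAb : ∀ y, |A y| ≤ CA * Real.exp (ϑ * (pinnedChain ω₂ lam β γ).hamiltonian N y))
    (hfb : ∀ y, |f y| ≤ C * Real.exp (ϑ * (pinnedChain ω₂ lam β γ).hamiltonian N y)) {lam' : ℝ} (hlam : 0 < lam') :
    Integrable (fun z => A z * ∫ t in Ioi (0 : ℝ), Real.exp (-(lam' * t)) *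
        ∫ y, f y ∂((pinnedChain ω₂ lam β γ).transitionKernel N T T t.toNNReal z))
      ((pinnedChain ω₂ lam β γ).gibbsMeasure N T) := by
  have hϑ1 : ϑ < 1 / T := by linarith
  obtain ⟨K, c, hK, hc, hb⟩ := pinnedChain_harris_bound hω hl hβ hγ hN0 hT hϑ0 hϑ1
  have hW := pinnedChain_abs_resolvent_le hω hl hβ hϑ0 hb hc hf hC hfb hlam
  exact (integrable_nice_mul_of_abs_le_exp hω hl hβ hT h2ϑ hA
    (pinnedChain_stronglyMeasurable_resolvent hω hl hβ.le hγ.le T T hf.measurable lam') hAb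
    (D := (|∫ y, f y ∂((pinnedChain ω₂ lam β γ).gibbsMeasure N T)| + K * C) / lam')
    (fun z => (hW z).trans_eq (by ring))).1

end Pinned

end Summit.AtomisticToContinuum.FouriersLaw.Theorems.OpenChainGreenKubo

end
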